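import Summits.HubbardSuperconductivity.HubbardSuperconductivity.Theorems.AnisotropyChordTransferFibre3FinXDCheck

/-!
# Route `AnisotropyChord` / H0 rotor rung: FIN per-`L` row-D (KT-2a″) cell facts, `L = 9`, cells 132–137

Kernel facts `xdCellAny0 9 (49/50) la lb aD = true` (in-kernel point tables, zero data; `decide +kernel`) for the combined-cell
grid of `L = 9` (g5 design, 1–2.5 % cells); assembled in `…FinXDNine`.  Prover seat `hubbard-h0-rotor-p3` g7; helper for piece A =
stmt-HubbardSuperconductivity-23918 of rung 19089 (`--supports`, helper class).  WHAT THIS IS NOT: nothing here proves superconductivity in the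
Hubbard model (rotor TARGET as worded stays FALSE, g15 verdict); kernel facts for ONE hypothesis of ONE conditional reduction.  No sorry.
-/

set_option linter.dupNamespace false
set_option autoImplicit false

namespace Summit.HubbardSuperconductivity.HubbardSuperconductivity.Theorems.AnisotropyChord.Transfer.Fibre3

namespace FinXD

/-- cell 132 of `L = 9` (`cert`). [folklore] -/
theorem xd9_132 : xdCellAny0 9 (49/50 : ℚ) 18065310710914649 18516943478687513 (3/50 : ℚ) = true := by decide +kernel

/-- cell 133 of `L = 9` (`cert`). [folklore] -/
theorem xd9_133 : xdCellAny0 9 (49/50 : ℚ) 18516943478687513 18979867065654701 (3/50 : ℚ) = true := by decide +kernel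

/-- cell 134 of `L = 9` (`cert`). [folklore] -/
theorem xd9_134 : xdCellAny0 9 (49/50 : ℚ) 18979867065654701 19454363742296065 (3/50 : ℚ) = true := by decide +kernel

/-- cell 135 of `L = 9` (`cert`). [folklore] -/
theorem xd9_135 : xdCellAny0 9 (49/50 : ℚ) 19454363742296065 19940722835853465 (3/50 : ℚ) = true := by decide +kernel

/-- cell 136 of `L = 9` (`cert`). [folklore] -/
theorem xd9_136 : xdCellAny0 9 (49/50 : ℚ) 19940722835853465 20439240906749801 (3/50 : ℚ) = true := by decide +kernel

/-- cell 137 of `L = 9` (`cert`). [folklore] -/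
theorem xd9_137 : xdCellAny0 9 (49/50 : ℚ) 20439240906749801 20950221929418545 (3/50 : ℚ) = true := by decide +kernel

end FinXD

end Summit.HubbardSuperconductivity.HubbardSuperconductivity.Theorems.AnisotropyChord.Transfer.Fibre3
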